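import Summits.HodgeConjecture.HodgeConjecture.Theorems.F0P3RelParityOfT5            -- ★ this pen (p843477∕p843496): `relSharpGuardedOneMeasure_of_T5` (REL♯ ⟸ T5, one measure, no seam)
import Summits.HodgeConjecture.HodgeConjecture.Theorems.F0P3KitOfRecordLettersV8Cot      -- ★ `letters_of_specPkgV8_cot` (the closer's fourteen-row hypothesis shape), ★ `laws₈_kitOfRecord_of₄`, ★ `isPinned_kitFamilyOfRecord`
import HarnessLib

/-!
# `F0P3RelParityOfRecord` — REL♯ (one measure) AT THE KIT FAMILY OF RECORD, from the closer's FOURTEEN ROWS: the F3′ bridge of the road «REL♯ ⟸ T5 at 𝔎₀»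

Cell `pub/hodgecm-mathlib`, F0∕P2 ∕ P3, crux H413 (`stmt-HodgeConjecture-24833`); books row #162 REL♯ «(C4)».  Pen F0P2-p02 (g9); P3 desk F0P3-plan (g9) RULING D31a
(«name the ★ bridge term or cut it (S) as F3′»).  THEOREMS ONLY; no def, no instance, no notation, no `sorry`; `--supports stmt-HodgeConjecture-24833 --as helper`.
HONEST LABEL: HC_CM is proved only modulo the printed citations until rung 0 closes; this file asserts nothing new — plumbing over ★ K-side V8 and ★ `F0P3RelParityOfT5`.

* **`lawsV8_kitFamilyOfRecord_of_rows 𝔇 h : F0P3InnerFormClassificationV8.KitFamily.Laws (kitFamilyOfRecord 𝔇)`** — the v8 family LAWS from the closer's fourteen per-frame rows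
  (`h` = the hypothesis of ★ `letters_of_specPkgV8_cot` VERBATIM; proof = its first three lines: ★ `lawsV8_kitFamilyOfRecord_of` ∘ ★ `laws₈_kitOfRecord_of₄`).  This is the bridge
  term the closer reaches only INSIDE ★ `letters_of_specPkgV8_cot`; exported here once, for every kit-generic consumer (#75's `aPacketMembersGuarded_of_T5`, REL♯, …).
* **`relSharpOneMeasure_of_rows 𝔇 h : ‹REL♯ at ONE automorphic measure, `CuspLabel` unfolded›`** := ★ `relSharpGuardedOneMeasure_of_T5 (kitFamilyOfRecord 𝔇)
  (isPinned_kitFamilyOfRecord 𝔇) (lawsV8_kitFamilyOfRecord_of_rows 𝔇 h)` — so that the closer's junction is ONE token next to `rows_of_rung0`: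
  `theorem relSharpOne_of_rung1 := relSharpOneMeasure_of_rows frameDataOfRung0 rows_of_rung0` (ED. 27 «REL♯₌ ⟸ T5», desk F0P3-plan D31a), #162 ↦ CLOSED-DERIVED over the
  closer's own rows once REL♯ is re-typed at one measure (P2 desk, REL-ENGINE ED. 3).
[cite: Rogawski1990, §14.6 Thm. 14.6.4 pp. 236–244; §13.1 Prop. 13.1.3 (d); §15.2 Prop. 15.2.1; §15.3 ¶1 p. 244]
-/

set_option autoImplicit false
set_option linter.dupNamespace false

noncomputable section

open NumberField IsDedekindDomain MeasureTheory
open Literature.NumberTheory.Rogawski1990 Literature.NumberTheory.GaloisRepresentations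
open Literature.NumberTheory.Automorphic Literature.NumberTheory.Automorphic.UnitaryGroup
open Literature.NumberTheory.Automorphic.UnitaryGroup.CotangentForms
open Summit.HodgeConjecture.HodgeConjecture.Cruxes.H413.F0P3XiArchPacketOfRecord (JInfNoDegOne DsInfNoDegOne)
open scoped Matrix ComplexOrder

namespace Summit.HodgeConjecture.HodgeConjecture.Cruxes.H413.F0P3KitOfRecord

open Summit.HodgeConjecture.HodgeConjecture.Cruxes.H413.F0P3InnerFormClassificationV6 (Sockets Gp Places Cinf IsCot KcTrivial)

/-- **THE v8 FAMILY LAWS FROM THE CLOSER'S FOURTEEN ROWS** (`h` = ★ `letters_of_specPkgV8_cot`'s hypothesis verbatim): ★ `lawsV8_kitFamilyOfRecord_of` ∘ ★ `laws₈_kitOfRecord_of₄`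
(with `Factorisation` from `FactorisationCls` + the package's `FactorisationPk`, ★ `factorisation_of_cls_of_pk`).  [cite: Rogawski1990, §14.6 Thm. 14.6.4 pp. 236–244; §14.2 p. 228] -/
theorem lawsV8_kitFamilyOfRecord_of_rows
    (𝔇 : ∀ (L : Type) [Field L] [NumberField L] [IsCMField L] (ι : L →+* ℂ) (H : Matrix (Fin 3) (Fin 3) L) (T : GL (Fin 3) ℂ)
      (hT : (T : Matrix (Fin 3) (Fin 3) ℂ)ᴴ * H.map ι * (T : Matrix (Fin 3) (Fin 3) ℂ) = Literature.Geometry.ComplexHyperbolic.BallModel.J),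
      (∀ τ' : L →+* ℂ, InfinitePlace.mk τ' ≠ InfinitePlace.mk ι → (H.map τ').PosDef) →
      2 ≤ Module.finrank ℚ ↥(maximalRealSubfield L) →
      ∀ (μ : Measure (Gp L H).automorphicQuotient) [(Gp L H).IsAutomorphicMeasure μ] (μω : HeckeCharacter L) (_hμu : μω.IsUnitary),
      (∀ x : Literature.NumberTheory.GaloisRepresentations.ideleGroup ↥(maximalRealSubfield L),
        μω (AdeleRing.ideleBaseChange (↥(maximalRealSubfield L)) L x) = quadraticHeckeCharCM L x) → FrameData L H ι T hT μ)
    (h : ∀ (L : Type) [Field L] [NumberField L] [IsCMField L] (ι : L →+* ℂ) (H : Matrix (Fin 3) (Fin 3) L) (T : GL (Fin 3) ℂ)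
      (hT : (T : Matrix (Fin 3) (Fin 3) ℂ)ᴴ * H.map ι * (T : Matrix (Fin 3) (Fin 3) ℂ) = Literature.Geometry.ComplexHyperbolic.BallModel.J)
      (hdef : ∀ τ' : L →+* ℂ, InfinitePlace.mk τ' ≠ InfinitePlace.mk ι → (H.map τ').PosDef) (h2 : 2 ≤ Module.finrank ℚ ↥(maximalRealSubfield L))
      (μ : Measure (Gp L H).automorphicQuotient) [(Gp L H).IsAutomorphicMeasure μ] (μω : HeckeCharacter L) (hμu : μω.IsUnitary)
      (hμω : ∀ x : Literature.NumberTheory.GaloisRepresentations.ideleGroup ↥(maximalRealSubfield L),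
        μω (AdeleRing.ideleBaseChange (↥(maximalRealSubfield L)) L x) = quadraticHeckeCharCM L x),
      -- ONE level `S₀` per frame (v8, RULING (V44)); the witnessed package at `S₀` (K9β: `Classical.choose_spec`, unioned by `.mono`)
      ∃ S₀ : Finset (Places L),
      F0P3InnerFormClassificationV8.ClassificationKit.SpecPkg (kitFamilyOfRecord 𝔇 L ι H T hT hdef h2 μ μω hμu hμω) S₀ ∧
      -- #1 (T1's head at the overridden kit, K9β §A), TF (class factorisation), #2, #6, #7, #8, #10, #15 (v8 text, GUARDED `IsCot P → KcTrivial P → …` — ★ `routing₈_kitOfRecord_of_cot`)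
      (kitFamilyOfRecord 𝔇 L ι H T hT hdef h2 μ μω hμu hμω).TraceIdentity ∧
      F0P3InnerFormClassificationV8.ClassificationKit.FactorisationCls (kitFamilyOfRecord 𝔇 L ι H T hT hdef h2 μ μω hμu hμω) S₀ ∧
      (kitFamilyOfRecord 𝔇 L ι H T hT hdef h2 μ μω hμu hμω).SpectralSideGp ∧
      F0P3InnerFormClassificationV8.ClassificationKit.HatBounded (kitFamilyOfRecord 𝔇 L ι H T hT hdef h2 μ μω hμu hμω) S₀ ∧
      F0P3InnerFormClassificationV8.ClassificationKit.UnrStarAlgebra (kitFamilyOfRecord 𝔇 L ι H T hT hdef h2 μ μω hμu hμω) S₀ ∧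
      (kitFamilyOfRecord 𝔇 L ι H T hT hdef h2 μ μω hμu hμω).LinIndepS ∧
      F0P3InnerFormClassificationV8.ClassificationKit.UnitaryPacket (kitFamilyOfRecord 𝔇 L ι H T hT hdef h2 μ μω hμu hμω) S₀ ∧
      F0P3InnerFormClassificationV8.ClassificationKit.Routing (kitFamilyOfRecord 𝔇 L ι H T hT hdef h2 μ μω hμu hμω) ∧
      -- the arch clauses on the family's `jInf dsInf` (R-22′) and the ξ-rows #20 #21 #23 (no #12 `FlathDet`, no «AFA»: RULINGS (V43)(V44))
      JInfNoDegOne (𝔇 L ι H T hT hdef h2 μ μω hμu hμω).jInf ∧ DsInfNoDegOne (𝔇 L ι H T hT hdef h2 μ μω hμu hμω).dsInf ∧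
      (kitFamilyOfRecord 𝔇 L ι H T hT hdef h2 μ μω hμu hμω).XiFamilyFin μω hμu ∧
      (kitFamilyOfRecord 𝔇 L ι H T hT hdef h2 μ μω hμu hμω).XiUnram ∧
      (kitFamilyOfRecord 𝔇 L ι H T hT hdef h2 μ μω hμu hμω).EvpConvention) :
    F0P3InnerFormClassificationV8.KitFamily.Laws (kitFamilyOfRecord 𝔇) := by
  refine lawsV8_kitFamilyOfRecord_of 𝔇 fun L _ _ _ ι H T hT hdef h2 μ _ μω hμu hμω => ?_
  obtain ⟨S₀, hpk, h1, hTF, h2', h6, h7, h8, h10, h15, hJ, hD, h20, h21, h23⟩ := h L ι H T hT hdef h2 μ μω hμu hμω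
  letI : MeasurableSpace (Gp L H).Adelic := borel _
  haveI : BorelSpace (Gp L H).Adelic := ⟨rfl⟩
  haveI := (𝔇 L ι H T hT hdef h2 μ μω hμu hμω).isFiniteMeasureOnCompacts_ν
  exact ⟨S₀, laws₈_kitOfRecord_of₄ L H ι T hT μ _ _ _ μω hμu _ _ _ _ _ _ _ S₀ hdef h2 h1 h2'
    (F0P3InnerFormClassificationV8.ClassificationKit.factorisation_of_cls_of_pk _ hTF hpk.factorisationPk) hpk.matchingS hpk.transferS h6 h7 h8 h10
    hpk.aPacketSpectral hpk.localExpansion h15 hμω hJ hD h20 h21 h23⟩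

set_option synthInstance.maxHeartbeats 400000 in
set_option maxHeartbeats 400000 in
-- the conclusion is the REL♯ text (scoped budget as in ★ `F0P3RelParityOfT5`)
/-- **REL♯ AT ONE AUTOMORPHIC MEASURE, AT THE KIT FAMILY OF RECORD, FROM THE FOURTEEN ROWS** — the closer's one-token junction shape (`relSharpOneMeasure_of_rows frameDataOfRung0
rows_of_rung0`): ★ `relSharpGuardedOneMeasure_of_T5` at `kitFamilyOfRecord 𝔇`, pinned by ★ `isPinned_kitFamilyOfRecord` (no hypothesis), laws by `lawsV8_kitFamilyOfRecord_of_rows`.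
[cite: Rogawski1990, §14.6 Thm. 14.6.4 pp. 236–239; §13.1 Prop. 13.1.3 (d) p. 199; §15.2 Prop. 15.2.1 p. 244] -/
theorem relSharpOneMeasure_of_rows
    (𝔇 : ∀ (L : Type) [Field L] [NumberField L] [IsCMField L] (ι : L →+* ℂ) (H : Matrix (Fin 3) (Fin 3) L) (T : GL (Fin 3) ℂ)
      (hT : (T : Matrix (Fin 3) (Fin 3) ℂ)ᴴ * H.map ι * (T : Matrix (Fin 3) (Fin 3) ℂ) = Literature.Geometry.ComplexHyperbolic.BallModel.J),
      (∀ τ' : L →+* ℂ, InfinitePlace.mk τ' ≠ InfinitePlace.mk ι → (H.map τ').PosDef) →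
      2 ≤ Module.finrank ℚ ↥(maximalRealSubfield L) →
      ∀ (μ : Measure (Gp L H).automorphicQuotient) [(Gp L H).IsAutomorphicMeasure μ] (μω : HeckeCharacter L) (_hμu : μω.IsUnitary),
      (∀ x : Literature.NumberTheory.GaloisRepresentations.ideleGroup ↥(maximalRealSubfield L),
        μω (AdeleRing.ideleBaseChange (↥(maximalRealSubfield L)) L x) = quadraticHeckeCharCM L x) → FrameData L H ι T hT μ)
    (h : ∀ (L : Type) [Field L] [NumberField L] [IsCMField L] (ι : L →+* ℂ) (H : Matrix (Fin 3) (Fin 3) L) (T : GL (Fin 3) ℂ)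
      (hT : (T : Matrix (Fin 3) (Fin 3) ℂ)ᴴ * H.map ι * (T : Matrix (Fin 3) (Fin 3) ℂ) = Literature.Geometry.ComplexHyperbolic.BallModel.J)
      (hdef : ∀ τ' : L →+* ℂ, InfinitePlace.mk τ' ≠ InfinitePlace.mk ι → (H.map τ').PosDef) (h2 : 2 ≤ Module.finrank ℚ ↥(maximalRealSubfield L))
      (μ : Measure (Gp L H).automorphicQuotient) [(Gp L H).IsAutomorphicMeasure μ] (μω : HeckeCharacter L) (hμu : μω.IsUnitary)
      (hμω : ∀ x : Literature.NumberTheory.GaloisRepresentations.ideleGroup ↥(maximalRealSubfield L),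
        μω (AdeleRing.ideleBaseChange (↥(maximalRealSubfield L)) L x) = quadraticHeckeCharCM L x),
      -- ONE level `S₀` per frame (v8, RULING (V44)); the witnessed package at `S₀` (K9β: `Classical.choose_spec`, unioned by `.mono`)
      ∃ S₀ : Finset (Places L),
      F0P3InnerFormClassificationV8.ClassificationKit.SpecPkg (kitFamilyOfRecord 𝔇 L ι H T hT hdef h2 μ μω hμu hμω) S₀ ∧
      -- #1 (T1's head at the overridden kit, K9β §A), TF (class factorisation), #2, #6, #7, #8, #10, #15 (v8 text, GUARDED `IsCot P → KcTrivial P → …` — ★ `routing₈_kitOfRecord_of_cot`)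
      (kitFamilyOfRecord 𝔇 L ι H T hT hdef h2 μ μω hμu hμω).TraceIdentity ∧
      F0P3InnerFormClassificationV8.ClassificationKit.FactorisationCls (kitFamilyOfRecord 𝔇 L ι H T hT hdef h2 μ μω hμu hμω) S₀ ∧
      (kitFamilyOfRecord 𝔇 L ι H T hT hdef h2 μ μω hμu hμω).SpectralSideGp ∧
      F0P3InnerFormClassificationV8.ClassificationKit.HatBounded (kitFamilyOfRecord 𝔇 L ι H T hT hdef h2 μ μω hμu hμω) S₀ ∧
      F0P3InnerFormClassificationV8.ClassificationKit.UnrStarAlgebra (kitFamilyOfRecord 𝔇 L ι H T hT hdef h2 μ μω hμu hμω) S₀ ∧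
      (kitFamilyOfRecord 𝔇 L ι H T hT hdef h2 μ μω hμu hμω).LinIndepS ∧
      F0P3InnerFormClassificationV8.ClassificationKit.UnitaryPacket (kitFamilyOfRecord 𝔇 L ι H T hT hdef h2 μ μω hμu hμω) S₀ ∧
      F0P3InnerFormClassificationV8.ClassificationKit.Routing (kitFamilyOfRecord 𝔇 L ι H T hT hdef h2 μ μω hμu hμω) ∧
      -- the arch clauses on the family's `jInf dsInf` (R-22′) and the ξ-rows #20 #21 #23 (no #12 `FlathDet`, no «AFA»: RULINGS (V43)(V44))
      JInfNoDegOne (𝔇 L ι H T hT hdef h2 μ μω hμu hμω).jInf ∧ DsInfNoDegOne (𝔇 L ι H T hT hdef h2 μ μω hμu hμω).dsInf ∧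
      (kitFamilyOfRecord 𝔇 L ι H T hT hdef h2 μ μω hμu hμω).XiFamilyFin μω hμu ∧
      (kitFamilyOfRecord 𝔇 L ι H T hT hdef h2 μ μω hμu hμω).XiUnram ∧
      (kitFamilyOfRecord 𝔇 L ι H T hT hdef h2 μ μω hμu hμω).EvpConvention) :
    ∀ (L : Type) [Field L] [NumberField L] [IsCMField L] (ι : L →+* ℂ) (H : Matrix (Fin 3) (Fin 3) L) (T : GL (Fin 3) ℂ)
      (hT : (T : Matrix (Fin 3) (Fin 3) ℂ)ᴴ * H.map ι * (T : Matrix (Fin 3) (Fin 3) ℂ) = Literature.Geometry.ComplexHyperbolic.BallModel.J),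
      (∀ τ' : L →+* ℂ, InfinitePlace.mk τ' ≠ InfinitePlace.mk ι → (H.map τ').PosDef) → 2 ≤ Module.finrank ℚ ↥(maximalRealSubfield L) →
        ∀ (μA : Measure (adelicGroupData (↥(maximalRealSubfield L)) L (IsCMField.complexConj L) 3 H).automorphicQuotient)
          [(adelicGroupData (↥(maximalRealSubfield L)) L (IsCMField.complexConj L) 3 H).IsAutomorphicMeasure μA]
          (P P' : DiscreteAutomorphicRep (adelicGroupData (↥(maximalRealSubfield L)) L (IsCMField.complexConj L) 3 H) μA),
          (P.IsHolCotangentAt (cmArchSection L ι H T hT) (cmCompactFactor L ι H T hT) ∨ P.IsAntiholCotangentAt (cmArchSection L ι H T hT) (cmCompactFactor L ι H T hT)) →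
          (P'.IsHolCotangentAt (cmArchSection L ι H T hT) (cmCompactFactor L ι H T hT) ∨ P'.IsAntiholCotangentAt (cmArchSection L ι H T hT) (cmCompactFactor L ι H T hT)) →
          ∀ (μω : HeckeCharacter L) (hμu : μω.IsUnitary),
            (∀ x : Literature.NumberTheory.GaloisRepresentations.ideleGroup ↥(maximalRealSubfield L),
              μω (AdeleRing.ideleBaseChange (↥(maximalRealSubfield L)) L x) = quadraticHeckeCharCM L x) →
          ∀ (ξ : OneDimAutRepH L),
            MemXiFamily P (transpose_map_cmConjRingHom_eq_of_frame L ι H T hT) (isUnit_det_of_frame L ι H T hT) μω hμu ξ →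
            MemXiFamily P' (transpose_map_cmConjRingHom_eq_of_frame L ι H T hT) (isUnit_det_of_frame L ι H T hT) μω hμu ξ →
              Even ({v : HeightOneSpectrum (𝓞 ↥(maximalRealSubfield L)) | ¬ ((∃ c : IrrClass ((cmDatum L 3 H).Local v),
                  (IrrClass.comap (localPiEquiv L (IsCMField.complexConj L) 3 H v) c).IsConstituentOf
                      (P.finRep.smoothPart.toRepresentation.comp (inclPlace (↥(maximalRealSubfield L)) L (IsCMField.complexConj L) 3 H v)) ∧
                    c.IsSupercuspidal) ↔
                (∃ c : IrrClass ((cmDatum L 3 H).Local v),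
                  (IrrClass.comap (localPiEquiv L (IsCMField.complexConj L) 3 H v) c).IsConstituentOf
                      (P'.finRep.smoothPart.toRepresentation.comp (inclPlace (↥(maximalRealSubfield L)) L (IsCMField.complexConj L) 3 H v)) ∧
                    c.IsSupercuspidal))}.ncard) :=
  F0P3RelParityOfT5.relSharpGuardedOneMeasure_of_T5 (kitFamilyOfRecord 𝔇) (isPinned_kitFamilyOfRecord 𝔇) (lawsV8_kitFamilyOfRecord_of_rows 𝔇 h)

end Summit.HodgeConjecture.HodgeConjecture.Cruxes.H413.F0P3KitOfRecord

end
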